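import Mathlib.Geometry.Manifold.PoincareConjecture
import Literature.Topology.FourManifolds.Trisections
import Literature.Topology.FourManifolds.ClosedBall
import HarnessLib

/-!
# 4-manifolds with weakly reducible genus-three trisections are standard (Aranda–Zupan 2025) —
homotopy-sphere corollary

Named fact (D-0014) requested by route SmoothPoincare4/WeakReductionDescent (`wi-38720`: its
support item `GenusThreeBase`, stmt-SmoothPoincare4-17910), over the tree's Gay–Kirby trisection
predicate `Literature.Topology.FourManifolds.IsGKTrisection` (`Trisections.lean`), in the style of
the genus-`≤ 2` corollaries `msz_standard_homotopySphere` / `mz_genus_le_two_homotopySphere`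
(`SmallTrisections.lean`).

Source read (held arXiv text, `paper:arxiv-2503.04607`): R. Aranda, A. Zupan, *Manifolds with
weakly reducible genus-three trisections are standard* (2025).

* **Theorem 1.3** (p. 2, verbatim): "Suppose `X` admits a weakly reducible genus-three trisection
  `𝒯`. Then either `𝒯` is reducible, or `𝒯` contains a five-chain. In particular, `X` is
  diffeomorphic to a spun lens space `S_p` or its sibling `S'_p`, `S⁴`, or a connected sum of copies
  of `±ℂP²`, `S¹ × S³`, and `S² × S²`."
* **Weak reducibility** (p. 2: "we say that `𝒯` is weakly reducible if there are disjoint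
  non-separating curves `c` and `c′` such that `c` bounds a disk in one of the three handlebodies,
  and `c′` bounds a disk in the other two"; p. 6: "`𝒯` is weakly reducible if there exist
  non-separating curves `c` and `c′` in `Σ` such that `c` is a compressing curve for `H_α` and `c′`
  is a compressing curve for both `H_β` and `H_γ`").
* `S_p`, `S'_p` (p. 7): the two manifolds obtained by surgery on a loop representing
  `p ∈ ℤ = π₁(S¹ × S³)`.

The route needs Theorem 1.3 only for HOMOTOPY 4-SPHERES, where every manifold of the printed list
other than `S⁴` is excluded by `π₁ = 1`, `H₂ = 0` (surgery on a loop of class `p` in `S¹ × S³` has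
`π₁ ≅ ℤ/p` — `S⁴` only for `p = ±1`, Pao/Meier; a connected sum with an `S¹ × S³` summand has
non-trivial `π₁`, one with a `±ℂP²` or `S² × S²` summand has `H₂ ≠ 0`). We therefore record the
corollary with conclusion "diffeomorphic to `S⁴`" (weaker than, and implied by, the printed
classification; the full list would need spun-lens-space / connected-sum vocabulary matched to
`IsGKTrisection`, not attempted), with the hypotheses spelled out EXACTLY as in the route item
`GenusThreeBase` so that it closes by `exact`:

* the 4-manifold: bare binders `(M : Type)` with `T2Space`, `SecondCountableTopology`,
  `ChartedSpace (EuclideanSpace ℝ (Fin 4))`, `IsManifold (𝓡 4) ∞` and a homotopy equivalence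
  `M ≃ₕ S⁴` (which forces `M` closed, connected and orientable: top `ℤ/2`-homology, `π₀`, `π₁`);
* the trisection: `IsGKTrisection M 3 k T` for some `k : Fin 3 → ℕ` (a `(3; k₀, k₁, k₂)`
  trisection with corners along the central surface `F = ⋂ T l`, handlebodies
  `H p = ⋂_{l ≠ p} T l`);
* weak reducibility: disjoint curves `c, c' ⊆ F` (images of smooth embeddings of `S¹`), both
  non-separating in `F` (`F ∖ c`, `F ∖ c'` connected), `c` bounding a smoothly embedded closed
  `2`-disc inside `H p` meeting `F` exactly in its boundary `c`, and `c'` bounding such discs in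
  both other handlebodies `H q`, `q ≠ p` — AZ's compressing discs (non-separating curves are
  essential), with the extra word "disjoint" of p. 2.

## References

* [ArandaZupan2025] R. Aranda, A. Zupan, *Manifolds with weakly reducible genus-three trisections
  are standard*, arXiv:2503.04607 (2025), Thm. 1.3 (p. 2), §2 (p. 6), §3 (p. 7).
* [GayKirby2016] D. Gay, R. Kirby, *Trisecting 4-manifolds*, Geom. Topol. 20 (2016), Def. 1.
* [MeierZupan2017] J. Meier, A. Zupan, *Genus two trisections are standard*, Geom. Topol. 21
  (2017) (the genus-`≤ 2` rungs, `SmallTrisections.lean`).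
-/

noncomputable section

open scoped Manifold ContDiff
open Set ContinuousMap

namespace Literature.Topology.FourManifolds

/-- **Aranda–Zupan 2025, Thm. 1.3 — homotopy-sphere corollary over `IsGKTrisection`.** Let `M` be
a smooth 4-manifold (Hausdorff, second countable, modelled on `ℝ⁴`, `C^∞`) homotopy equivalent to
`S⁴`, with a Gay–Kirby `(3; k₀, k₁, k₂)`-trisection `T` (`IsGKTrisection M 3 k T`; central surface
`F = ⋂ T l`, handlebodies `H p = ⋂_{l ≠ p} T l`) which is **weakly reducible**: there are disjoint
smoothly embedded circles `c, c' ⊆ F`, both non-separating in `F`, such that `c` bounds a smoothly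
embedded closed disc in one handlebody `H p` meeting `F` exactly along `c`, and `c'` bounds such
discs in the two other handlebodies. Then `M` is diffeomorphic to `S⁴`. Printed theorem (p. 2):
"Suppose `X` admits a weakly reducible genus-three trisection `𝒯`. Then either `𝒯` is reducible,
or `𝒯` contains a five-chain. In particular, `X` is diffeomorphic to a spun lens space `S_p` or its
sibling `S'_p`, `S⁴`, or a connected sum of copies of `±ℂP²`, `S¹ × S³`, and `S² × S²`" — and a
homotopy 4-sphere in this list is `S⁴` (`π₁(S_p) ≅ ℤ/p`, `S_{±1} = S'_{±1} = S⁴`; the non-trivial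
connected sums have `π₁ ≠ 1` or `H₂ ≠ 0`). Statement = the route item `GenusThreeBase` of
`Summits/SmoothPoincare4/…/Theses/WeakReductionDescent.lean`, verbatim. Named fact (D-0014).
[cite: ArandaZupan2025, Thm. 1.3 (p. 2) with the definition of weak reducibility (pp. 2, 6)] -/
def arandaZupan_weaklyReducible_genusThree_homotopySphere : Prop :=
  ∀ (M : Type) [TopologicalSpace M] [T2Space M] [SecondCountableTopology M]
    [ChartedSpace (EuclideanSpace ℝ (Fin 4)) M] [IsManifold (𝓡 4) ((⊤ : ℕ∞) : WithTop ℕ∞) M],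
    (M ≃ₕ (Metric.sphere (0 : EuclideanSpace ℝ (Fin 5)) 1)) →
    ∀ (k : Fin 3 → ℕ) (T : Fin 3 → Set M),
      Literature.Topology.FourManifolds.IsGKTrisection M 3 k T →
      (let F : Set M := ⋂ l, T l
       let H : Fin 3 → Set M := fun p => ⋂ (l : Fin 3) (_ : l ≠ p), T l
       let IsCurve : Set M → Prop := fun c => c ⊆ F ∧
         ∃ γ : (Metric.sphere (0 : EuclideanSpace ℝ (Fin 2)) 1) → M,
           Manifold.IsSmoothEmbedding (𝓡 1) (𝓡 4) ((⊤ : ℕ∞) : WithTop ℕ∞) γ ∧ Set.range γ = c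
       let BoundsDisc : Set M → Set M → Prop := fun A c =>
         ∃ d : (Metric.closedBall (0 : EuclideanSpace ℝ (Fin 2)) 1) → M,
           Manifold.IsSmoothEmbedding (𝓡∂ 2) (𝓡 4) ((⊤ : ℕ∞) : WithTop ℕ∞) d ∧
             Set.range d ⊆ A ∧
             d '' ((𝓡∂ 2).boundary (Metric.closedBall (0 : EuclideanSpace ℝ (Fin 2)) 1)) = c ∧
             Set.range d ∩ F = c
       let NonSep : Set M → Prop := fun c => IsConnected (F \ c)
       let WeaklyReducible : Prop := ∃ (p : Fin 3) (c c' : Set M), IsCurve c ∧ IsCurve c' ∧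
         Disjoint c c' ∧ NonSep c ∧ NonSep c' ∧ BoundsDisc (H p) c ∧
         ∀ q : Fin 3, q ≠ p → BoundsDisc (H q) c'
       WeaklyReducible) →
      Nonempty (Diffeomorph (𝓡 4) (𝓡 4) M (Metric.sphere (0 : EuclideanSpace ℝ (Fin 5)) 1)
        ((⊤ : ℕ∞) : WithTop ℕ∞))

end Literature.Topology.FourManifolds

end
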